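import Summits.QuantumFields.YangMills.Theorems.SqueezedSkewnessIsotypicProjections
import Mathlib.Analysis.InnerProductSpace.Trace
import HarnessLib

/-!
# ENGINE-KL layer (K4b) for `SqueezedSkewness.TorusKL` (stmt-QuantumFields-23204, stub `stub_torusMixtureData`):
# ADAPTED ORTHONORMAL BASES — inside a finite-dimensional invariant subspace of a finite abelian norm-preserving
# representation there is an orthonormal basis of JOINT EIGENVECTORS, and traces over it equal traces over any other basis

Pure operator theory (Mathlib + the isotypic toolkit `SqueezedSkewnessIsotypicProjections`), generic complex inner-product space `H`:
a norm-preserving representation `V` of a finite additive commutative group `Γ` with a bicharacter `χ` (orthogonality relations as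
hypotheses, exactly the §A currency of the toolkit), an orthonormal family `v` and a finite set `s` of indices such that the span
`M = span_ℂ {v i : i ∈ s}` is `V`-invariant.  THEN (`exists_adapted_orthonormal_family`):
* there are `d : Γ → ℕ` and an orthonormal family `e : (Σ q, Fin (d q)) → H` inside `M` of JOINT EIGENVECTORS, `V γ (e ⟨q,j⟩) = χ_q(γ) e ⟨q,j⟩`
  (restrict `V` to `M`, decompose `M` by the isotypic projections `Π_q = |Γ|⁻¹ Σ_γ conj χ_q(γ) V γ`, collect orthonormal bases of their
  ranges: `DirectSum.IsInternal.collectedOrthonormalBasis`);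
* and for EVERY bounded operator `T` of `H` the trace over the adapted family equals the trace over the generators:
  `Σ_k ⟪e k, T (e k)⟫ = Σ_{i ∈ s} ⟪v i, T (v i)⟫` (`LinearMap.trace_eq_sum_inner` for the compression of `T` to `M`, two orthonormal bases).
This is how the eigenspaces of the (complexified) transfer operator are re-based on joint eigenvectors of the spatial translations
without changing the spectral sums (layer K4c).  Seat `ym-line-fcl-p3` g16; theorems only; nothing about a summit, NT or the mass gap.
References: J.-P. Serre, *Linear Representations of Finite Groups*, §2.6; M. Reed, B. Simon, *Methods of Modern Mathematical Physics I*
(1980) [cite: ReedSimonI1980, Thm. VI.16].  [folklore]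
-/

set_option autoImplicit false

noncomputable section

open scoped InnerProductSpace ComplexConjugate BigOperators
open Submodule

namespace Summit.QuantumFields.YangMills.Theorems.TorusKL.AdaptedBasis

open Summit.QuantumFields.YangMills.Theorems.SqueezedSkewnessJointDiagonal

variable {H : Type*} [NormedAddCommGroup H] [InnerProductSpace ℂ H]
variable {Γ : Type*} [AddCommGroup Γ] [Fintype Γ] [DecidableEq Γ]

/-- **Trace invariance on a finite-dimensional subspace**: for two orthonormal bases of a finite-dimensional subspace `M` of `H`
(given as families in `H`) and any bounded `T`, `Σ ⟪e k, T (e k)⟫ = Σ ⟪f i, T (f i)⟫` — both are the trace of the compression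
`P_M T|_M`. [folklore] -/
theorem sum_inner_apply_eq_of_orthonormalBasis {M : Submodule ℂ H} [FiniteDimensional ℂ M] {κ ι : Type*} [Fintype κ]
    [Fintype ι] (e : OrthonormalBasis κ ℂ M) (f : OrthonormalBasis ι ℂ M) (T : H →L[ℂ] H) :
    ∑ k, ⟪(e k : H), T (e k)⟫_ℂ = ∑ i, ⟪(f i : H), T (f i)⟫_ℂ := by
  haveI : M.HasOrthogonalProjection := inferInstance
  set TM : M →ₗ[ℂ] M := (M.orthogonalProjectionOnto.comp (T.comp M.subtypeL) : M →L[ℂ] M).toLinearMap with hTM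
  have hdiag : ∀ x : M, ⟪x, TM x⟫_ℂ = ⟪(x : H), T x⟫_ℂ := fun x => by
    rw [hTM]
    show ⟪x, M.orthogonalProjectionOnto (T (x : H))⟫_ℂ = _
    rw [inner_orthogonalProjectionOnto_eq_of_mem_left]
  have h1 := LinearMap.trace_eq_sum_inner TM e
  have h2 := LinearMap.trace_eq_sum_inner TM f
  simp only [hdiag] at h1 h2
  rw [← h1, ← h2]

/-- ★ **Adapted orthonormal family with trace invariance.**  Let `V` be a norm-preserving representation of the finite abelian
`Γ` on `H` with bicharacter `χ` (toolkit hypotheses), `v` an orthonormal family and `s` a finite index set whose span `M` is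
`V`-invariant.  Then there is an orthonormal family `e : (Σ q, Fin (d q)) → H` in `M` of joint eigenvectors,
`V γ (e k) = χ_{k.1}(γ) e k`, with `Σ_k ⟪e k, T (e k)⟫ = Σ_{i∈s} ⟪v i, T (v i)⟫` for every bounded `T`. [folklore] -/
theorem exists_adapted_orthonormal_family (χ : Γ → Γ → ℂ) (V : Γ → H →L[ℂ] H)
    (hχadd : ∀ q γ γ', χ q (γ + γ') = χ q γ * χ q γ')
    (hχconj : ∀ q γ, conj (χ q γ) = χ q (-γ))
    (hχorth : ∀ q q', ∑ γ, χ q γ * conj (χ q' γ) = if q = q' then (Fintype.card Γ : ℂ) else 0)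
    (hχdual : ∀ γ, ∑ q, conj (χ q γ) = if γ = 0 then (Fintype.card Γ : ℂ) else 0)
    (hV0 : V 0 = 1) (hVadd : ∀ γ γ', V (γ + γ') = V γ * V γ') (hVnorm : ∀ γ x, ‖V γ x‖ = ‖x‖)
    {ι : Type*} {v : ι → H} (hv : Orthonormal ℂ v) (s : Finset ι)
    (hVM : ∀ γ, ∀ i ∈ s, V γ (v i) ∈ span ℂ (v '' (s : Set ι))) :
    ∃ (d : Γ → ℕ) (e : (Σ q : Γ, Fin (d q)) → H), Orthonormal ℂ e ∧ (∀ k, e k ∈ span ℂ (v '' (s : Set ι))) ∧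
      (∀ k γ, V γ (e k) = χ k.1 γ • e k) ∧
      ∀ T : H →L[ℂ] H, ∑ k, ⟪e k, T (e k)⟫_ℂ = ∑ i ∈ s, ⟪v i, T (v i)⟫_ℂ := by
  classical
  have himg : (s.image v : Set H) = v '' (s : Set ι) := Finset.coe_image
  set M : Submodule ℂ H := span ℂ (v '' (s : Set ι)) with hM
  haveI : FiniteDimensional ℂ M := FiniteDimensional.span_of_finite ℂ ((s.finite_toSet).image v)
  -- invariance of `M`
  have hinv : ∀ γ, ∀ x ∈ M, V γ x ∈ M := by
    intro γ x hx
    refine span_induction (p := fun x _ => V γ x ∈ M) ?_ ?_ ?_ ?_ hx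
    · intro y hy
      obtain ⟨i, hi, rfl⟩ := hy
      exact hVM γ i (Finset.mem_coe.1 hi)
    · simp
    · intro x y _ _ hx hy; rw [map_add]; exact add_mem hx hy
    · intro a x _ hx; rw [map_smul]; exact smul_mem _ _ hx
  -- the restricted representation `u`
  set u : Γ → M →L[ℂ] M := fun γ => LinearMap.toContinuousLinearMap (((V γ : H →L[ℂ] H) : H →ₗ[ℂ] H).restrict (hinv γ))
    with hu
  have hu_coe : ∀ γ (x : M), ((u γ x : M) : H) = V γ x := fun γ x => rfl
  have hu0 : u 0 = 1 := by
    ext x; rw [hu_coe, hV0]; rfl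
  have huadd : ∀ γ γ', u (γ + γ') = u γ * u γ' := fun γ γ' => by
    ext x; rw [hu_coe, hVadd]; rfl
  have hunorm : ∀ γ (x : M), ‖u γ x‖ = ‖x‖ := fun γ x => by
    rw [← norm_coe, hu_coe, hVnorm, norm_coe]
  -- isotypic projections on `M`
  set Pr : Γ → M →L[ℂ] M := fun q => ((Fintype.card Γ : ℂ)⁻¹) • ∑ γ, conj (χ q γ) • u γ with hPr_def
  have hPr : ∀ q, Pr q = ((Fintype.card Γ : ℂ)⁻¹) • ∑ γ, conj (χ q γ) • u γ := fun q => rfl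
  have hVP := rep_mul_proj χ u Pr hχadd hχconj huadd hPr
  have hPP := proj_mul_proj χ u Pr hχadd hχconj hχorth huadd hPr
  have hsum := sum_proj χ u Pr hχdual hu0 hPr
  have hsym := inner_proj_left χ u Pr hχconj hu0 huadd hunorm hPr
  -- the ranges and their orthogonality / internal direct sum
  set W : Γ → Submodule ℂ M := fun q => LinearMap.range (Pr q).toLinearMap with hW
  have hWmem : ∀ q (x : M), x ∈ W q ↔ ∃ y, Pr q y = x := fun q x => LinearMap.mem_range
  have horth : OrthogonalFamily ℂ (fun q => W q) fun q => (W q).subtypeₗᵢ := by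
    intro q q' hqq' x y
    obtain ⟨x0, hx0⟩ := (hWmem q x).1 x.2
    obtain ⟨y0, hy0⟩ := (hWmem q' y).1 y.2
    show ⟪(x : M), (y : M)⟫_ℂ = 0
    rw [← hx0, ← hy0, hsym, ← mul_apply_eq_comp, hPP, if_neg hqq']
    exact inner_zero_right _
  have htop : iSup W = ⊤ := by
    rw [eq_top_iff]
    intro x _
    have hx : x = ∑ q, Pr q x := by
      rw [← _root_.sum_apply, hsum, one_apply_eq_self]
    rw [hx]
    exact Submodule.sum_mem _ fun q _ => Submodule.mem_iSup_of_mem q ((hWmem q _).2 ⟨x, rfl⟩)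
  have hint : DirectSum.IsInternal W := (horth.isInternal_iff).2 (by rw [htop, Submodule.top_orthogonal_eq_bot])
  -- the collected orthonormal basis of joint eigenvectors
  set onb := hint.collectedOrthonormalBasis horth (fun q => stdOrthonormalBasis ℂ (W q)) with honb
  have honb_mem : ∀ k, onb k ∈ W k.1 := fun k => hint.collectedOrthonormalBasis_mem horth _ k
  have heig : ∀ k γ, u γ (onb k) = χ k.1 γ • onb k := by
    intro k γ
    obtain ⟨y, hy⟩ := (hWmem k.1 _).1 (honb_mem k)
    rw [← hy, ← mul_apply_eq_comp, hVP, _root_.smul_apply]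
  -- the orthonormal basis of the generators
  have hMeq : span ℂ (s.image v : Set H) = M := by rw [hM, himg]
  set bf : OrthonormalBasis s ℂ M := (OrthonormalBasis.span hv s).map (LinearIsometryEquiv.ofEq _ _ hMeq) with hbf
  have hbf_apply : ∀ i : s, (bf i : H) = v i := fun i => by
    rw [hbf, OrthonormalBasis.map_apply, LinearIsometryEquiv.coe_ofEq_apply, OrthonormalBasis.span_apply]
  refine ⟨fun q => Module.finrank ℂ (W q), fun k => (onb k : H), ?_, fun k => (onb k).2, ?_, fun T => ?_⟩
  · exact (M.subtypeₗᵢ.orthonormal_comp_iff).2 onb.orthonormal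
  · intro k γ
    rw [← hu_coe, heig, Submodule.coe_smul]
  · rw [sum_inner_apply_eq_of_orthonormalBasis onb bf T, ← Finset.sum_coe_sort s]
    refine Finset.sum_congr rfl fun i _ => ?_
    rw [hbf_apply]

end Summit.QuantumFields.YangMills.Theorems.TorusKL.AdaptedBasis

end
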